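import Literature.Algebra.Homology.CharpolyHomologyShortExact
import Literature.Algebra.Homology.LefschetzNumberMappingCone
import Literature.Algebra.Homology.CharpolyShift
import HarnessLib

/-!
# Characteristic polynomials on cohomology of a mapping cone: `∏ᶠ χ(Hⁱ(cone-map))^{±} = ∏ᶠ χ(Hⁱψ)^{±} · (∏ᶠ χ(Hⁱφ)^{±})⁻¹`

Layer `Literature/Algebra/Homology` (pure linear algebra over Mathlib; proved theorems only, 0 definitions, 0 named facts, no instances,
no notation). The charpoly member under rows `EulerCharacteristicMappingCone` (`χ`) and `LefschetzNumberMappingCone` (`Λ`): for a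
commutative square `f ≫ ψ = φ ≫ f` of endomorphisms of cochain complexes of finite-dimensional vector spaces (finitely many non-zero
terms), Mathlib's `mappingCone.map f f φ ψ comm` is the middle of an endomorphism of the short exact sequence
`G ⟶ cone f ⟶ F⟦1⟧` (row `EulerCharacteristicMappingCone`'s `shortExact_triangleRotateShortComplex`, row `LefschetzNumberMappingCone`'s
`mappingCone_map_comm`); row `CharpolyHomologyShortExact` and row `CharpolyShift` then give, in `RatFunc K`,

  **`finprod_charpoly_homologyMap_mappingCone_map : ∏ᶠ i, χ(Hⁱ(mappingCone.map f f φ ψ comm))^{(−1)ⁱ} =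
    (∏ᶠ i, χ(Hⁱ(ψ))^{(−1)ⁱ}) · (∏ᶠ i, χ(Hⁱ(φ))^{(−1)ⁱ})⁻¹`**.

Rows `EulerCharacteristicMappingCone` / `LefschetzNumberMappingCone` are NOT restated. Library only (cell `pub-hodge-ring2`, count-neutral);
proves nothing about any crux, route or conjecture.

## References

* C. A. Weibel, *An Introduction to Homological Algebra* (1994), §1.5, §10.2 (mapping cones). [Weibel1994]
* S. Lang, *Algebra* (2002), Ch. XX §3 (Euler–Poincaré maps). [Lang2002]
-/

open CategoryTheory CategoryTheory.Limits CochainComplex Polynomial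

universe v u

namespace Literature.Algebra.Homology.HopfTrace

variable {K : Type u} [Field K] {F G : CochainComplex (ModuleCat.{v} K) ℤ} (f : F ⟶ G) (φ : F ⟶ F) (ψ : G ⟶ G)
  (comm : f ≫ ψ = φ ≫ f)

/-- **Characteristic polynomials on the cohomology of a mapping cone**: for a commutative square `f ≫ ψ = φ ≫ f` of endomorphisms of
cochain complexes of finite-dimensional spaces with finitely many non-zero terms,
`∏ᶠ i, χ(Hⁱ(mappingCone.map f f φ ψ comm))^{(−1)ⁱ} = (∏ᶠ i, χ(Hⁱ(ψ))^{(−1)ⁱ}) · (∏ᶠ i, χ(Hⁱ(φ))^{(−1)ⁱ})⁻¹` in `RatFunc K`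
(the instance on the cone's cohomology is row `HopfTraceFormula`'s `moduleFinite_homology`). [cite: Weibel1994, §1.5] [cite: Lang2002, Ch. XX §3] -/
theorem finprod_charpoly_homologyMap_mappingCone_map [∀ i, Module.Finite K (F.X i)] [∀ i, Module.Finite K (G.X i)]
    [∀ i, Module.Finite K (F.homology i)] [∀ i, Module.Finite K (G.homology i)] [∀ i, Module.Finite K ((mappingCone f).homology i)]
    (hF : (GradedObject.finrankSupport F.X).Finite) (hG : (GradedObject.finrankSupport G.X).Finite) :
    ∏ᶠ i, algebraMap K[X] (RatFunc K) (HomologicalComplex.homologyMap (mappingCone.map f f φ ψ comm) i).hom.charpoly ^ ((i.negOnePow : ℤ)) =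
      (∏ᶠ i, algebraMap K[X] (RatFunc K) (HomologicalComplex.homologyMap ψ i).hom.charpoly ^ ((i.negOnePow : ℤ))) *
        (∏ᶠ i, algebraMap K[X] (RatFunc K) (HomologicalComplex.homologyMap φ i).hom.charpoly ^ ((i.negOnePow : ℤ)))⁻¹ := by
  -- homology supports of `F`, `G` are finite (bounded by the term supports)
  have hsub : ∀ (E : CochainComplex (ModuleCat.{v} K) ℤ) [∀ i, Module.Finite K (E.X i)],
      (GradedObject.finrankSupport fun i => E.homology i) ⊆ GradedObject.finrankSupport E.X := fun E _ i hi => by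
    simp only [GradedObject.finrankSupport, Function.mem_support, ne_eq] at hi ⊢
    exact fun h0 => hi (Nat.eq_zero_of_le_zero (h0 ▸ EulerPoincare.finrank_homology_le E i))
  have hFh : (GradedObject.finrankSupport fun i => F.homology i).Finite := hF.subset (hsub F)
  have hGh : (GradedObject.finrankSupport fun i => G.homology i).Finite := hG.subset (hsub G)
  -- the rotated triangle of the cone as a short exact sequence with its endomorphism
  haveI : ∀ i, Module.Finite K ((mappingCone.triangleRotateShortComplex f).X₁.homology i) :=
    fun i => inferInstanceAs (Module.Finite K (G.homology i))
  haveI : ∀ i, Module.Finite K ((mappingCone.triangleRotateShortComplex f).X₂.homology i) :=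
    fun i => inferInstanceAs (Module.Finite K ((mappingCone f).homology i))
  haveI h3i : ∀ i, Module.Finite K (((CategoryTheory.shiftFunctor _ (1 : ℤ)).obj F).homology i) :=
    fun i => EulerCharShift.moduleFinite_shift_homology F 1 i
  haveI : ∀ i, Module.Finite K ((mappingCone.triangleRotateShortComplex f).X₃.homology i) := h3i
  let τ : mappingCone.triangleRotateShortComplex f ⟶ mappingCone.triangleRotateShortComplex f :=
    ShortComplex.homMk ψ (mappingCone.map f f φ ψ comm) ((CategoryTheory.shiftFunctor _ (1 : ℤ)).map φ)
      (Lefschetz.mappingCone_map_comm f φ ψ comm).1 (Lefschetz.mappingCone_map_comm f φ ψ comm).2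
  have h := finprod_charpoly_homologyMap_X₂_eq (EulerCharMappingCone.shortExact_triangleRotateShortComplex f) τ hGh
    (EulerCharShift.finrankSupport_shift_homology_finite F 1 hFh)
  have h3 : ∏ᶠ i, algebraMap K[X] (RatFunc K)
      (HomologicalComplex.homologyMap ((CategoryTheory.shiftFunctor _ (1 : ℤ)).map φ) i).hom.charpoly ^ ((i.negOnePow : ℤ)) =
      (∏ᶠ i, algebraMap K[X] (RatFunc K) (HomologicalComplex.homologyMap φ i).hom.charpoly ^ ((i.negOnePow : ℤ)))⁻¹ := by
    rw [finprod_charpoly_homologyMap_shift F φ 1 hFh, Int.negOnePow_one, Units.val_neg, Units.val_one, zpow_neg, zpow_one]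
  exact h.trans (by rw [← h3]; rfl)

end Literature.Algebra.Homology.HopfTrace
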